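import Literature.AlgebraicGeometry.Resolution.AlterationsNormalForm
import Literature.AlgebraicGeometry.Resolution.AlterationsEnlargingZ
import Literature.AlgebraicGeometry.Resolution.AdicCompletionRegular
import Literature.AlgebraicGeometry.Resolution.FormalFibresRegularProofs
import Literature.AlgebraicGeometry.Resolution.MarkedIdealsLemmas
import Mathlib.AlgebraicGeometry.AlgClosed.Basic
import Mathlib.RingTheory.AdicCompletion.LocalRing
import HarnessLib

/-!
# Formal coordinates adapted to a regular system of parameters (for de Jong 1996, 4.25 (i))

Topic: `Literature/AlgebraicGeometry/Resolution`. Situation 4.25 of de Jong 1996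
(`DeJong1996.NormalFormPair`, `AlterationsNormalForm.lean`) records normal crossings FORMALLY:
at a nonsingular closed point `x` of `Z`, "`(𝒪̂_{X,x}, Î_Z) ≅ (k⟦x₁, …, x_d⟧, (x₁ ⋯ x_r))`". This
file provides the passage from the local ring to its completion that every proof of such a
statement ends with — Cohen's structure theorem in the sharp form "a regular system of
parameters becomes the system of variables":

* `exists_ringEquiv_adicCompletion_mvPowerSeries_of_rsop` — for a regular local ring `B`
  containing a field, an isomorphism `ι` of its residue field with a field `K`, and a regular
  system of parameters `z₁, …, z_d` (`d = dim B`), there is a ring isomorphism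
  `e : B̂ ≃+* K⟦X₁, …, X_d⟧` of the `𝔪`-adic completion with `e(zᵢ) = Xᵢ`. (Matsumura, Thm. 29.7
  / proof of 29.4: "if `x₁, …, xₙ` is a regular system of parameters of `A` then
  `A = R⟦x₁, …, xₙ⟧ ≃ R⟦X₁, …, Xₙ⟧`", applied to `A = B̂`, which is again regular with the same
  embedding dimension and residue field, the `zᵢ` staying a regular system of parameters; the
  expansion map is `comp_map_bijective` of `FormalFibresRegularProofs.lean`.)
* `exists_ringEquiv_adicCompletion_stalk_mvPowerSeries` — the same for the local ring `𝒪_{X,x}`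
  at a regular closed point of a scheme locally of finite type over an algebraically closed
  field `k`, with `K = k` (the residue field of a closed point is `k`, Mathlib's
  `residueFieldIsoBase`).
* `completedStalkIdeal_map_eq_span_normalCrossingsEquation` — consequently, if the stalk of an
  ideal sheaf `I` at `x` is `(z₁ ⋯ z_r)`, then `e` carries the completed stalk ideal
  `Î = I · 𝒪̂_{X,x}` (`completedStalkIdeal`) to `(X₁ ⋯ X_r)` (`DeJong1996.normalCrossingsEquation`),
  which is the shape of `DeJong1996.NormalFormPair.exists_ringEquiv_of_isRegularLocalRing`.

## Sources

* H. Matsumura, *Commutative Ring Theory* (1986), Thm. 28.3 (ii), Thm. 29.7 and the proof of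
  Thm. 29.4 (p. 225). [Matsumura1987]
* A. J. de Jong, *Smoothness, semi-stability and alterations* (1996), 4.25 (i), p. 75.
-/

noncomputable section

open CategoryTheory AlgebraicGeometry TopologicalSpace IsLocalRing

namespace Literature.AlgebraicGeometry.Resolution

universe u

/-! ## Changing the coefficients of a power series ring along a ring isomorphism -/

/-- A ring isomorphism of coefficient rings induces one of power series rings (coefficientwise).
[folklore] -/
def MvPowerSeries.mapRingEquiv {σ : Type*} {R S : Type*} [CommRing R] [CommRing S] (ι : R ≃+* S) :
    MvPowerSeries σ R ≃+* MvPowerSeries σ S :=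
  RingEquiv.ofRingHom (MvPowerSeries.map (σ := σ) ι.toRingHom)
    (MvPowerSeries.map (σ := σ) ι.symm.toRingHom)
    (by ext f e; simp)
    (by ext f e; simp)

/-- The coefficient change fixes the variables. [folklore] -/
@[simp]
theorem MvPowerSeries.mapRingEquiv_X {σ : Type*} {R S : Type*} [CommRing R] [CommRing S]
    (ι : R ≃+* S) (i : σ) : MvPowerSeries.mapRingEquiv ι (MvPowerSeries.X i) = MvPowerSeries.X i := by
  change MvPowerSeries.map (σ := σ) ι.toRingHom (MvPowerSeries.X i) = _
  exact MvPowerSeries.map_X _ i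

/-! ## Cohen coordinates adapted to a regular system of parameters -/

/-- **Formal coordinates adapted to a regular system of parameters** (Matsumura, Thm. 29.7 with
the proof of Thm. 29.4: "if `x₁, …, xₙ` is a regular system of parameters of `A` then
`A = R⟦x₁, …, xₙ⟧ ≃ R⟦X₁, …, Xₙ⟧`"). Let `B` be a regular local ring of dimension `d` containing a
field `k₀`, let `ι : B/𝔪 ≃ K`, and let `z₁, …, z_d` generate `𝔪`. Then there is a ring
isomorphism `e` of the `𝔪`-adic completion `B̂` with `K⟦X₁, …, X_d⟧` sending (the image of) `zᵢ`
to `Xᵢ`. Proof: `B̂` is a complete regular local ring with `emb dim B̂ = emb dim B = d`, residue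
field `B/𝔪` and maximal ideal `𝔪B̂ = (z₁, …, z_d)`; it contains the field `k₀`, hence a
coefficient field (Thm. 28.3 (ii)), and the expansion map `K⟦X⟧ → B̂`, `Xᵢ ↦ zᵢ`, is bijective
(`comp_map_bijective`). [cite: Matsumura1987, Thm. 29.7] -/
theorem exists_ringEquiv_adicCompletion_mvPowerSeries_of_rsop (B : Type u) [CommRing B]
    [IsRegularLocalRing B] (k₀ : Subring B) (hk₀ : IsField k₀) {K : Type u} [Field K]
    (ι : ResidueField B ≃+* K) {d : ℕ} (z : Fin d → B)
    (hz : Ideal.span (Set.range z) = maximalIdeal B) (hd : ringKrullDim B = d) :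
    ∃ e : AdicCompletion (maximalIdeal B) B ≃+* MvPowerSeries (Fin d) K,
      ∀ i, e (algebraMap B (AdicCompletion (maximalIdeal B) B) (z i)) = MvPowerSeries.X i := by
  set A := AdicCompletion (maximalIdeal B) B with hA
  haveI : IsRegularLocalRing A := isRegularLocalRing_adicCompletion B
  -- `B → B̂` is injective (`B` is `𝔪`-adically separated)
  have hinj : Function.Injective (algebraMap B A) := fun a b h =>
    AdicCompletion.of_injective (maximalIdeal B) B h
  -- the field `k₀` inside `B̂`
  let k₁ : Subring A := k₀.map (algebraMap B A)
  have hk₁ : IsField k₁ :=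
    MulEquiv.isField hk₀ (k₀.equivMapOfInjective (algebraMap B A) hinj).symm.toMulEquiv
  -- a coefficient field: a section `σ` of the residue map of `B̂`
  obtain ⟨σ, hσ⟩ :=
    Literature.RingTheory.CompleteLocalRings.exists_ringHom_comp_residue_eq_id_of_subring A k₁ hk₁
  -- the regular system of parameters `z` of `B̂`
  let z' : Fin d → A := fun i => algebraMap B A (z i)
  have hmax : maximalIdeal A = (maximalIdeal B).map (algebraMap B A) :=
    AdicCompletion.maximalIdeal_eq_map
  have hz' : Ideal.span (Set.range z') = maximalIdeal A := by
    have h1 : (Ideal.span (Set.range z)).map (algebraMap B A) = Ideal.span (Set.range z') := by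
      rw [Ideal.map_span, ← Set.range_comp]
      rfl
    rw [← h1, congrArg (Ideal.map (algebraMap B A)) hz]
    exact hmax.symm
  have hz'm : ∀ i, z' i ∈ maximalIdeal A := fun i => hz' ▸ Ideal.subset_span ⟨i, rfl⟩
  have hd' : (maximalIdeal A).spanFinrank = d := by
    rw [AdicCompletion.spanFinrank_maximalIdeal_eq]
    exact spanFinrank_maximalIdeal_eq_of_ringKrullDim_eq hd
  -- the expansion map `K'⟦X⟧ → B̂`, `Xᵢ ↦ zᵢ`, is bijective
  obtain ⟨Φ, hΦ₁, hΦ₂⟩ := exists_adicEvalHom (maximalIdeal A) z' hz'm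
  have hbij := comp_map_bijective σ hσ hd' z' hz' Φ hΦ₁ hΦ₂
  let e₀ : A ≃+* MvPowerSeries (Fin d) (ResidueField A) := (RingEquiv.ofBijective _ hbij).symm
  have he₀ : ∀ i, e₀ (z' i) = MvPowerSeries.X i := by
    intro i
    apply (RingEquiv.ofBijective _ hbij).injective
    rw [RingEquiv.apply_symm_apply, RingEquiv.ofBijective_apply, RingHom.comp_apply,
      MvPowerSeries.map_X, ← MvPolynomial.coe_X, hΦ₁, MvPolynomial.eval_X]
  -- the residue field of `B̂` is that of `B`, which is `K`
  let ρ : ResidueField B ≃+* ResidueField A :=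
    RingEquiv.ofBijective _ (AdicCompletion.residueField_map_bijective B)
  let e₁ : MvPowerSeries (Fin d) (ResidueField A) ≃+* MvPowerSeries (Fin d) K :=
    MvPowerSeries.mapRingEquiv (ρ.symm.trans ι)
  refine ⟨e₀.trans e₁, fun i => ?_⟩
  rw [RingEquiv.trans_apply]
  change e₁ (e₀ (z' i)) = _
  rw [he₀, MvPowerSeries.mapRingEquiv_X]

/-! ## The local ring at a regular closed point of a scheme of finite type over an algebraically
closed field -/

/-- **Formal coordinates at a regular closed point**: for a scheme `X` locally of finite type over
an algebraically closed field `k`, a closed point `x` with `𝒪_{X,x}` regular of dimension `d`, and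
generators `z₁, …, z_d` of `𝔪ₓ`, there is `e : 𝒪̂_{X,x} ≃+* k⟦X₁, …, X_d⟧` with `e(zᵢ) = Xᵢ`
(`exists_ringEquiv_adicCompletion_mvPowerSeries_of_rsop` with the field `k ⊆ 𝒪_{X,x}` and
`κ(x) = k`, the residue field of a closed point of a finite type scheme over the algebraically
closed `k`). [cite: Matsumura1987, Thm. 29.7] -/
theorem exists_ringEquiv_adicCompletion_stalk_mvPowerSeries {k : Type u} [Field k]
    [IsAlgClosed k] {X : Scheme.{u}} (f : X ⟶ Spec (.of k)) [LocallyOfFiniteType f] {x : X}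
    (hx : IsClosed ({x} : Set X)) [IsRegularLocalRing (X.presheaf.stalk x)] {d : ℕ}
    (z : Fin d → X.presheaf.stalk x)
    (hz : Ideal.span (Set.range z) = maximalIdeal (X.presheaf.stalk x))
    (hd : ringKrullDim (X.presheaf.stalk x) = d) :
    ∃ e : AdicCompletion (maximalIdeal (X.presheaf.stalk x)) (X.presheaf.stalk x) ≃+*
        MvPowerSeries (Fin d) k,
      ∀ i, e (algebraMap _ _ (z i)) = MvPowerSeries.X i := by
  -- the field `k` inside `𝒪_{X,x}`: `k = Γ(Spec k) → Γ(X) → 𝒪_{X,x}`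
  let φ : k →+* X.presheaf.stalk x :=
    (X.presheaf.germ ⊤ x trivial).hom.comp
      (f.appTop.hom.comp (Scheme.ΓSpecIso (.of k)).inv.hom)
  have hφ : Function.Injective φ := φ.injective
  let k₀ : Subring (X.presheaf.stalk x) := φ.range
  have hk₀ : IsField k₀ :=
    MulEquiv.isField (Field.toIsField k) (RingEquiv.ofBijective φ.rangeRestrict
      ⟨fun a b h => hφ (congrArg Subtype.val h), φ.rangeRestrict_surjective⟩).symm.toMulEquiv
  -- the residue field `κ(x) = k`
  let ι : ResidueField (X.presheaf.stalk x) ≃+* k :=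
    (residueFieldIsoBase f x hx).commRingCatIsoToRingEquiv
  exact exists_ringEquiv_adicCompletion_mvPowerSeries_of_rsop (X.presheaf.stalk x) k₀ hk₀ ι z hz hd

/-! ## Completed stalk ideals in formal coordinates -/

/-- The completed stalk of an ideal sheaf is the extension of its stalk:
`completedStalkIdeal I x U hU = I_x · 𝒪̂_{X,x}`. [folklore] -/
theorem completedStalkIdeal_eq_map_stalkIdeal {X : Scheme.{u}} (I : X.IdealSheafData) (x : X)
    (U : X.affineOpens) (hU : x ∈ (U : X.Opens)) :
    completedStalkIdeal I x U hU = (stalkIdeal I x).map (algebraMap (X.presheaf.stalk x)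
      (AdicCompletion (maximalIdeal (X.presheaf.stalk x)) (X.presheaf.stalk x))) := by
  rw [completedStalkIdeal, stalkIdeal_eq_map_germ I U hU]

/-- **Formal normal crossings from a regular system of parameters.** If `e : 𝒪̂_{X,x} ≃ k⟦X⟧`
sends the generators `z₁, …, z_d` of `𝔪ₓ` to the variables and the stalk of the ideal sheaf `I`
at `x` is `(z₁ ⋯ z_r)` (the product over the indices `< r`), then `e` carries the completed stalk
ideal of `I` to `(X₁ ⋯ X_r)` (`DeJong1996.normalCrossingsEquation k d r`) — the shape of
Situation 4.25 (i). [cite: DeJong1996, 4.25 (i), p. 75] -/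
theorem completedStalkIdeal_map_eq_span_normalCrossingsEquation {k : Type u} [Field k]
    {X : Scheme.{u}} {x : X} {d : ℕ} (z : Fin d → X.presheaf.stalk x) (r : ℕ)
    (e : AdicCompletion (maximalIdeal (X.presheaf.stalk x)) (X.presheaf.stalk x) ≃+*
      MvPowerSeries (Fin d) k)
    (he : ∀ i, e (algebraMap _ _ (z i)) = MvPowerSeries.X i) (I : X.IdealSheafData)
    (hI : stalkIdeal I x =
      Ideal.span {∏ i ∈ Finset.univ.filter (fun i : Fin d => i.val < r), z i})
    (U : X.affineOpens) (hU : x ∈ (U : X.Opens)) :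
    (completedStalkIdeal I x U hU).map e.toRingHom =
      Ideal.span {DeJong1996.normalCrossingsEquation k d r} := by
  rw [completedStalkIdeal_eq_map_stalkIdeal, hI, Ideal.map_span, Set.image_singleton,
    Ideal.map_span, Set.image_singleton]
  refine congrArg (fun a => Ideal.span {a}) ?_
  rw [map_prod (algebraMap (X.presheaf.stalk x) _), RingEquiv.toRingHom_eq_coe, RingHom.coe_coe,
    map_prod e, DeJong1996.normalCrossingsEquation]
  exact Finset.prod_congr rfl fun i _ => he i

end Literature.AlgebraicGeometry.Resolution

end
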